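import Literature.NumberTheory.GaloisRepresentations.PstWeilDeligneTateTwist
import Literature.NumberTheory.GaloisRepresentations.TateTwistFrobeniusProofs
import Literature.NumberTheory.GaloisRepresentations.WeakAbelianDirectSummandCyclotomicProofs
import Literature.NumberTheory.GaloisRepresentations.LocalKroneckerWeberInertiaProofs
import Literature.NumberTheory.GaloisRepresentations.GlobalArtinMapOfCharactersProofs
import Summits.Langlands.Langlands.Theorems.IrreducibilityBySelfDualityReciprocityUpToIrreducibilityWeakExistence
import HarnessLib

/-!
# Stub W of line `Sketch` (crux `ReciprocityUpToIrreducibility`, item stmt-Langlands-14328) in rank one: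
# Hecke characters `χ₀ ‖·‖^k` of finite-order `χ₀` unramified above `ℓ` (continuation lead c3)

Support file (closes nothing).  The accepted `…ReciprocityUpToIrreducibilityWeakExistence` proves the
registered open stub W (Buzzard–Gee Conj. 3.2.2, weak form) for `GL_1` in the sector "`π` transforms
by `χ ∘ det` with `χ` of FINITE ORDER and unramified above `ℓ`", and records that outside that sector
the de Rham clause at `v ∣ ℓ` (for Fontaine's PINNED datum) was not dischargeable.  With the accepted
`PstWeilDeligneTateTwist` (Tate twists of de Rham representations are de Rham for every datum with
Fontaine's clauses — under the T0 fact `FontaineDatumExists` for the pinned one) the sector extends to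
every INFINITE-ORDER character of the shape `χ = χ₀ · ‖·‖^k`, `k ∈ ℤ`, `χ₀` of finite order and
unramified above `ℓ` — over `ℚ` and over totally real `K` these are all algebraic Hecke characters up
to the restriction on `χ₀` above `ℓ` (Weil 1956):

* `weakExistence_rankOne_of_isFiniteOrder_normTwist` — the `ℓ`-adic avatar is the Tate twist
  `ρ = r₀ ⊗ ε_ℓ^k` of the Artin avatar `r₀` of `χ₀` (`HeckeCharacter.exists_lAdic_of_isFiniteOrder`) by
  the `k`-th power of the cyclotomic character (`exists_cyclotomicCharacter_padicAlgCl_zpow`); at the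
  cofinitely many `v ∤ ℓ` where `π` is unramified, `χ₀` is unramified with Satake parameter
  `{χ₀(ϖ_v) q_v^{-k}}` and `ρ(Frob_v) = ι⁻¹(χ₀(ϖ_v))⁻¹ q_v^k` (`TateTwistFrobeniusProofs`); above `ℓ`,
  `ρ|_{Γ_{K_v}} = r₀|_{Γ_{K_v}} ⊗ ε_{ℓ,v}^k` with `r₀` unramified at `v`, de Rham for the pinned datum by
  `fontainePstAdicCompletion_isDeRhamFramed_tateTwist_of_isLocallyUnramified`.

No definitions; std axioms; conditional exactly on `FontaineDatumExists` (the named T0 fact that makes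
the `ε`-pinned datum satisfy clause (F2) "the cyclotomic character is de Rham").
-/

noncomputable section

set_option linter.dupNamespace false -- project-wide option (lakefile weak.linter.dupNamespace); `Summit.Langlands.Langlands` is the mandated namespace

open scoped MatrixGroups Matrix NumberField Classical Polynomial
open Filter IsDedekindDomain Field Polynomial
open Literature.NumberTheory.Automorphic Literature.NumberTheory.GaloisRepresentations
open Literature.NumberTheory.PAdicHodge
open Summit.Langlands

namespace Summit.Langlands.Langlands.Theorems.ReciprocityUpToIrreducibility

variable {K : Type} [Field K] [NumberField K] {ℓ : ℕ} [Fact ℓ.Prime]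

/-! ## 1. Two small lemmas: integer powers of Hecke characters; restriction of a twist to a decomposition group -/

/-- `(χ^k)(x) = χ(x)^k` for `k ∈ ℤ` (evaluation at an idele is a group homomorphism,
`HeckeCharacter.evalIdele`). [folklore] -/
theorem heckeCharacter_zpow_apply (χ : HeckeCharacter K) (k : ℤ) (x : ideleGroup K) :
    (χ ^ k) x = (χ x) ^ k := by
  rw [← HeckeCharacter.evalIdele_apply x (χ ^ k), map_zpow, HeckeCharacter.evalIdele_apply]

/-- **Restriction to a decomposition group commutes with twisting**:
`(r ⊗ ε)|_{Γ_{K_v}} = r|_{Γ_{K_v}} ⊗ ε|_{Γ_{K_v}}`. [folklore] -/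
theorem toLocal_twist {A : Type*} [CommRing A] [TopologicalSpace A] [IsTopologicalRing A] {n : ℕ}
    (r : FramedGaloisRep K A n) (ε : absoluteGaloisGroup K →ₜ* Aˣ) (v : HeightOneSpectrum (𝓞 K)) :
    FramedGaloisRep.toLocal v (r.twist ε) =
      (FramedGaloisRep.toLocal v r).twist (ε.comp (absGaloisRestrict K (v.adicCompletion K))) :=
  ContinuousMonoidHom.ext fun _ => rfl

/-! ## 2. W in rank one for `χ₀ ‖·‖^k` -/

/-- **Stub W (weak existence) for `GL_1`, sector "Hecke character `χ₀ ‖·‖^k` with `χ₀` of finite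
order and unramified above `ℓ`"** (under `FontaineDatumExists`).  Let `π` be a cuspidal automorphic
datum of `GL_1(𝔸_K)` transforming by `χ ∘ det` with `χ = χ₀ · ‖·‖^k`, `k ∈ ℤ`, `χ₀` of finite order and
unramified at every `v ∣ ℓ`, and let `ι : ℚ̄_ℓ ≃+* ℂ`.  Then there is `ρ : Γ_K → GL_1(ℚ̄_ℓ)` unramified
almost everywhere, de Rham at every `v ∣ ℓ` for Fontaine's pinned datum, and Satake–Frobenius
compatible with `(π, ι)` at all but finitely many places: `ρ = r₀ ⊗ ε_ℓ^k`, the Artin avatar of `χ₀`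
twisted by the `k`-th power of the cyclotomic character.  (Such `π` are L-algebraic; the sector of the
accepted `weakExistence_rankOne_of_isFiniteOrder` is `k = 0`.)
[cite: BuzzardGeeLMS2014, Conj. 3.2.2 (case n = 1)] [cite: SerreAbelianLadic1968, Ch. I §1.2 and Ch. III §2.3]
[cite: FontaineAsterisque223III, Exp. III Prop. 1.5.2] -/
theorem weakExistence_rankOne_of_isFiniteOrder_normTwist (hF : FontaineDatumExists)
    (hcpt : isCompact_glFiniteIntegralLevel 1 K) (π : CuspidalAutomorphicRepData 1 K hcpt)
    {χ₀ : HeckeCharacter K} (k : ℤ)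
    (hχ : ∀ (g : (AdelicGroupData.gl 1 K).Adelic), ∀ φ ∈ π.1.W,
      rightTranslation (AdelicGroupData.gl 1 K) g φ -
        (((χ₀ * HeckeCharacter.normCharacter K ^ k) (Matrix.GeneralLinearGroup.det g) : ℂˣ) : ℂ) • φ ∈
          π.1.W')
    (hfin : χ₀.IsFiniteOrder)
    (hχℓ : ∀ v : HeightOneSpectrum (𝓞 K), ((ℓ : ℕ) : 𝓞 K) ∈ v.asIdeal → χ₀.IsUnramifiedAt v)
    (ι : PadicAlgCl ℓ ≃+* ℂ) :
    ∃ ρ : FramedGaloisRep K (PadicAlgCl ℓ) 1,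
      ((∀ᶠ v : HeightOneSpectrum (𝓞 K) in cofinite, ρ.IsUnramifiedAt v) ∧
        ∀ (v : HeightOneSpectrum (𝓞 K)) (hv : ((ℓ : ℕ) : 𝓞 K) ∈ v.asIdeal),
          (fontainePstAdicCompletion v ℓ hv).IsDeRhamFramed (ρ.toLocal v)) ∧
      ∀ᶠ v : HeightOneSpectrum (𝓞 K) in cofinite, SatakeFrobCompatibleAt ι π.1 ρ v := by
  classical
  obtain ⟨r, hram, hfrob⟩ := χ₀.exists_lAdic_of_isFiniteOrder hfin ι
  obtain ⟨ε, hε⟩ := exists_cyclotomicCharacter_padicAlgCl_zpow K ℓ k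
  have hunrπ : ∀ᶠ v : HeightOneSpectrum (𝓞 K) in cofinite, π.1.IsUnramifiedAt v :=
    π.1.hasSatakeParamAt_cofinite_holds
  -- Satake–Frobenius compatibility at the unramified places away from `ℓ`
  have key : ∀ᶠ v : HeightOneSpectrum (𝓞 K) in cofinite, SatakeFrobCompatibleAt ι π.1 (r.twist ε) v := by
    filter_upwards [hunrπ, FramedGaloisRep.eventually_natCast_not_mem K ℓ] with v hv hvℓ
    obtain ⟨α, hα⟩ := hv
    have hur : (χ₀ * HeckeCharacter.normCharacter K ^ k).IsUnramifiedAt v :=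
      π.1.isUnramifiedAt_heckeCharacter_glOne hχ hα
    have hur₀ : χ₀.IsUnramifiedAt v := fun u => by
      have h1 := hur u
      have h2 := HeckeCharacter.isUnramifiedAt_normCharacter v u
      rw [HeckeCharacter.localComponent_apply] at h1 h2 ⊢
      rw [HeckeCharacter.mul_apply, heckeCharacter_zpow_apply, h2, one_zpow, mul_one] at h1
      exact h1
    refine ⟨α, hα, FramedGaloisRep.isUnramifiedAt_twist ((hram v).2 hur₀)
      (fun 𝔓 h𝔓 σ hσ => eq_one_of_mem_inertia_of_cyclotomic_zpow hε hvℓ h𝔓 hσ), ?_⟩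
    obtain ⟨ϖ, hϖ, rfl⟩ := π.1.exists_eq_singleton_of_hasSatakeParamAt_glOne hχ hα
    have hval : (((χ₀ * HeckeCharacter.normCharacter K ^ k) (localUnits v ϖ) : ℂˣ) : ℂ) =
        χ₀.valueAtUniformizer v * ((v.residueCard : ℂ)⁻¹) ^ k := by
      rw [HeckeCharacter.mul_apply, Units.val_mul, heckeCharacter_zpow_apply,
        Units.val_zpow_eq_zpow_val, ← HeckeCharacter.localComponent_apply,
        ← HeckeCharacter.localComponent_apply,
        HeckeCharacter.localComponent_eq_valueAtUniformizer hur₀ hϖ,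
        HeckeCharacter.localComponent_eq_valueAtUniformizer
          (HeckeCharacter.isUnramifiedAt_normCharacter v) hϖ,
        HeckeCharacter.valueAtUniformizer_normCharacter]
    rw [arithFrobPolyOfSatake_one, Multiset.map_singleton, Multiset.prod_singleton, hval]
    have hroot : ι.symm (χ₀.valueAtUniformizer v * ((v.residueCard : ℂ)⁻¹) ^ k)⁻¹ =
        (v.residueCard : PadicAlgCl ℓ) ^ k * ι.symm (χ₀.valueAtUniformizer v)⁻¹ := by
      rw [mul_inv, inv_zpow, inv_inv, map_mul, map_zpow₀, map_natCast, mul_comm]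
    have h0 : r.HasFrobCharpolyAt v
        (({ι.symm (χ₀.valueAtUniformizer v)⁻¹} : Multiset (PadicAlgCl ℓ)).map fun b => X - C b).prod := by
      rw [Multiset.map_singleton, Multiset.prod_singleton]
      exact hfrob v hur₀
    have htw := FramedGaloisRep.hasFrobCharpolyAt_twist_of_eq_prod h0 (χ := ε)
      (c := (v.residueCard : PadicAlgCl ℓ) ^ k)
      (fun 𝔓 h𝔓 σ hσ => coe_apply_of_isArithFrobAt_of_cyclotomic_zpow hε hvℓ h𝔓 hσ)
    rw [Multiset.map_singleton, Multiset.prod_singleton] at htw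
    rw [hroot]
    exact htw
  refine ⟨r.twist ε, ⟨key.mono fun v ⟨_, _, h, _⟩ => h, fun v hv => ?_⟩, key⟩
  -- de Rham above `ℓ`: `ρ|_{Γ_{K_v}} = r|_{Γ_{K_v}} ⊗ ε_{ℓ,v}^k` with `r` unramified at `v`
  haveI : NeZero ((ℓ : ℕ) : K) := ⟨Nat.cast_ne_zero.2 (Fact.out : ℓ.Prime).ne_zero⟩
  have hr₀ : (r.toLocal v).IsLocallyUnramified :=
    isLocallyUnramified_toLocal_of_isUnramifiedAt r v ((hram v).2 (hχℓ v hv))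
  rw [toLocal_twist]
  refine fontainePstAdicCompletion_isDeRhamFramed_tateTwist_of_isLocallyUnramified hF v hv hr₀ k _
    fun σ => ?_
  show ((ε (absGaloisRestrict K (v.adicCompletion K) σ) : (PadicAlgCl ℓ)ˣ) : PadicAlgCl ℓ) = _
  rw [hε, cyclotomicCharacter_absGaloisRestrict]

/-- **Closed form of `weakExistence_rankOne_of_isFiniteOrder_normTwist`** (all binders explicit, in
the order `hF, K, ℓ, hcpt, π, χ₀, k`): the shape in which this sector is registered as a stub of the
crux (`stub_weakExistence_rankOne_normTwist`). [cite: BuzzardGeeLMS2014, Conj. 3.2.2 (case n = 1)] -/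
theorem stub_weakExistence_rankOne_normTwist :
    FontaineDatumExists → ∀ (K : Type) [Field K] [NumberField K] (ℓ : ℕ) [Fact ℓ.Prime]
      (hcpt : isCompact_glFiniteIntegralLevel 1 K) (π : CuspidalAutomorphicRepData 1 K hcpt)
      (χ₀ : HeckeCharacter K) (k : ℤ),
      (∀ (g : (AdelicGroupData.gl 1 K).Adelic), ∀ φ ∈ π.1.W,
        rightTranslation (AdelicGroupData.gl 1 K) g φ -
          (((χ₀ * HeckeCharacter.normCharacter K ^ k) (Matrix.GeneralLinearGroup.det g) : ℂˣ) : ℂ) • φ ∈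
            π.1.W') →
      χ₀.IsFiniteOrder →
      (∀ v : HeightOneSpectrum (𝓞 K), ((ℓ : ℕ) : 𝓞 K) ∈ v.asIdeal → χ₀.IsUnramifiedAt v) →
      ∀ ι : PadicAlgCl ℓ ≃+* ℂ,
        ∃ ρ : FramedGaloisRep K (PadicAlgCl ℓ) 1,
          ((∀ᶠ v : HeightOneSpectrum (𝓞 K) in cofinite, ρ.IsUnramifiedAt v) ∧
            ∀ (v : HeightOneSpectrum (𝓞 K)) (hv : ((ℓ : ℕ) : 𝓞 K) ∈ v.asIdeal),
              (Literature.NumberTheory.PAdicHodge.fontainePstAdicCompletion v ℓ hv).IsDeRhamFramed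
                (ρ.toLocal v)) ∧
          ∀ᶠ v : HeightOneSpectrum (𝓞 K) in cofinite, SatakeFrobCompatibleAt ι π.1 ρ v :=
  fun hF _ _ _ _ _ hcpt π _ k hχ hfin hχℓ ι =>
    weakExistence_rankOne_of_isFiniteOrder_normTwist hF hcpt π k hχ hfin hχℓ ι

end Summit.Langlands.Langlands.Theorems.ReciprocityUpToIrreducibility

end
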